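import Mathlib.LinearAlgebra.Dimension.Free
import Mathlib.LinearAlgebra.FreeModule.Finite.Basic
import Mathlib.RingTheory.TensorProduct.Free
import Literature.AlgebraicGeometry.Motives.BettiRealization
import HarnessLib

/-!
# The pure-`(p,p)` re-decoration of a Betti–Hodge realization datum (even degrees)

`Literature.AlgebraicGeometry.Motives.BettiHodgeData k` (`Motives/BettiRealization`) is a
HYPOTHESIS STRUCTURE standing in for the classical Betti–Hodge realization: a Weil cohomology
`W`, a comparison `iso` with Betti cohomology, and, for each smooth projective `X` and each `i`,
SOME pure Hodge structure `B.hodge hX i` of weight `i` on `Hⁱ(X)`, subject only to (a) pull-backs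
are morphisms of Hodge structures, (b) each `B.hodge hX i` is polarizable, (c) cycle classes are
Hodge classes. The companion file `Motives/BettiRealizationWeil` records that (a)–(c) do not
determine the ODD-degree Hodge numbers (Weil's two-type structure). This file records the
even-degree counterpart, which is what every Hodge-conjecture-type statement written against an
abstract `B` is sensitive to: from any datum `B` we build `B.pureEven`, with the same `W` and
`iso`, whose Hodge structure on `H²ᵖ(X)` is the structure PURELY OF TYPE `(p,p)`
(`HodgeStructure.pure`, Deligne, *Théorie de Hodge II*, 2.1.13: the Hodge structures of Tate
type, `F^p = everything`, `F^{p+1} = 0`) and unchanged in odd degree. The axioms survive: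
(a) any linear map between two structures purely of type `(p,p)` respects the one-step
filtrations (`HodgeStructure.Hom.pureOfEven`); (b) a structure purely of type `(p,p)` on a
finite-dimensional `V` is polarized, in the untwisted convention `i^{p-q} Q(x, x̄) > 0` of
`HodgeStructure.Polarization`, by the sum-of-squares form of any basis, `Q(v, w) = Σᵢ vᵢ wᵢ`,
since `Q_ℂ(x, x̄) = Σᵢ |xᵢ|²` (`HodgeStructure.isPolarizable_pure`; Voisin, *Hodge Theory I*,
§7.1.2; the weight-`0` case is the trivial Hodge structure `ℚ(0)ⁿ`); (c) EVERY class of `H²ᵖ(X)`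
is then a Hodge class (`BettiHodgeData.hodgeClasses_pureEven_two_mul`), in particular every
cycle class.

Consequently the `B`-relative Hodge conjecture `B.pureEven.HodgeConjectureFor hX p` reads
"the classes of codimension-`p` cycles SPAN `H²ᵖ(X)`" (`pureEven_hodgeConjectureFor_iff`), and
it fails as soon as the original datum sees one non-zero off-diagonal Hodge number
`h^{p',q'}(B, X) ≠ 0`, `p' ≠ p`, in degree `2p` (`not_pureEven_hodgeConjectureFor_of_hodgeNumber_ne_zero`,
through the linear-algebra lemma `HodgeStructure.hodgeNumber_eq_zero_of_hodgeClasses_eq_top`: a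
weight-`2p` Hodge structure all of whose rational vectors are Hodge classes is purely of type
`(p,p)`). Hence no statement of the form "`B.HodgeConjectureFor hX p` for every datum `B`" can
hold at such an `(X, p)` (`not_forall_hodgeConjectureFor_of_hodgeNumber_ne_zero`): the tree's
statements against an abstract `B` (`Motives/Sweep1`: `ZuckerCubicFourfoldStatement B`,
`ConteMurreQuarticQuinticStatement B`, `ShiodaFermatStatement B`; `Motives/BettiCycleClass`:
`LefschetzOneOneStatement B`; `Motives/AbstractHodgeTate`: `HodgeConjectureOver k B`) are
PREDICATES of `B`, true at most for data whose even-degree Hodge structures are the right ones,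
never theorems about all `B` — exactly as their docstrings say ("not a consequence of the fields
of an abstract `B`"). Used in `Motives/Sweep1PureEven` for Zucker's theorem on cubic fourfolds.

## Main definitions and results (all proved; no named facts)

* `HodgeStructure.sumSqForm b`, `sumSqForm_baseChange_apply`, `sumSqForm_baseChange_conj`:
  the sum-of-squares form of a basis and `Q_ℂ(x, x̄) = Σᵢ |xᵢ|²` on the complexification.
* `HodgeStructure.Polarization.pure`, `HodgeStructure.isPolarizable_pure`: structures purely of
  type `(k,k)` on finite-dimensional spaces are polarizable.
* `HodgeStructure.F_eq_top_of_hodgeClasses_eq_top`, `…F_eq_bot_of_hodgeClasses_eq_top`,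
  `…piece_eq_bot_of_hodgeClasses_eq_top`, `…hodgeNumber_eq_zero_of_hodgeClasses_eq_top`:
  `Hdgᵖ = V` forces purity of type `(p,p)`.
* `HodgeStructure.pureOfEven H` (pure of type `(n/2, n/2)` if the weight `n` is even, else `H`),
  `Hom.pureOfEven`, `IsPolarizable.pureOfEven`, `hodgeClasses_pureOfEven_of_even`.
* `BettiHodgeData.pureEven B`, `pureEven_W`, `pureEven_hodge`, `hodgeClasses_pureEven_two_mul`,
  `pureEven_hodgeConjectureFor_iff`, `algebraicClasses_ne_top_of_hodgeNumber_ne_zero`,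
  `not_pureEven_hodgeConjectureFor_of_hodgeNumber_ne_zero`,
  `not_forall_hodgeConjectureFor_of_hodgeNumber_ne_zero`.

## References

* P. Deligne, *Théorie de Hodge II*, Publ. Math. IHÉS 40 (1971), 2.1.13 (Hodge structures of
  Tate type) and 2.1.15 (polarizations).
* C. Voisin, *Hodge Theory and Complex Algebraic Geometry I* (CUP 2002), §7.1.1–7.1.2
  (Hodge structures, polarizations), §11.3 (Hodge classes).
* S. Kleiman, *Algebraic cycles and the Weil conjectures* (1968), §1.2 (A) (finite
  dimensionality of `Hⁱ(X)`).
-/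

open scoped TensorProduct

noncomputable section

namespace Literature.AlgebraicGeometry.Motives

universe u v

namespace HodgeStructure

variable {V : Type u} [AddCommGroup V] [Module ℚ V]
variable {W : Type v} [AddCommGroup W] [Module ℚ W]

/-! ### The sum-of-squares form of a basis and its complexification -/

section SumOfSquares

variable {ι : Type*} [Fintype ι]

/-- The **sum-of-squares form** of a basis `b` of the `ℚ`-vector space `V`:
`Q_b(v, w) = Σᵢ vᵢ wᵢ` in `b`-coordinates (the standard positive definite symmetric form;
Voisin I, §7.1.2: a polarization of the trivial Hodge structure). [folklore] -/
def sumSqForm (b : Module.Basis ι ℚ V) : LinearMap.BilinForm ℚ V :=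
  ∑ i, (LinearMap.mul ℚ ℚ).compl₁₂ (b.coord i) (b.coord i)

/-- `Q_b(v, w) = Σᵢ vᵢ wᵢ`. [folklore] -/
@[simp]
theorem sumSqForm_apply (b : Module.Basis ι ℚ V) (v w : V) :
    sumSqForm b v w = ∑ i, b.repr v i * b.repr w i := by
  simp [sumSqForm, LinearMap.sum_apply]

/-- The sum-of-squares form is symmetric. [folklore] -/
theorem sumSqForm_comm (b : Module.Basis ι ℚ V) (v w : V) :
    sumSqForm b v w = sumSqForm b w v := by
  simp only [sumSqForm_apply, mul_comm]

omit [Fintype ι] in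
/-- Coordinates of a conjugate vector in the complexified basis `1 ⊗ bᵢ` are the conjugates
of the coordinates: `(x̄)ᵢ = conj (xᵢ)` (the basis vectors are real). [folklore] -/
theorem basis_repr_conj (b : Module.Basis ι ℚ V) (x : ℂ ⊗[ℚ] V) (i : ι) :
    (Algebra.TensorProduct.basis ℂ b).repr (conj x) i =
      starRingEnd ℂ ((Algebra.TensorProduct.basis ℂ b).repr x i) := by
  induction x using TensorProduct.induction_on with
  | zero => simp
  | tmul a v =>
    simp only [conj_tmul, Algebra.TensorProduct.basis_repr_tmul, Finsupp.smul_apply,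
      Finsupp.mapRange_apply, smul_eq_mul, map_mul, eq_ratCast, map_ratCast]
  | add x y hx hy => simp [map_add, hx, hy]

/-- The complexified sum-of-squares form in the complexified basis:
`Q_{b,ℂ}(x, y) = Σᵢ xᵢ yᵢ`. [folklore] -/
theorem sumSqForm_baseChange_apply (b : Module.Basis ι ℚ V) (x y : ℂ ⊗[ℚ] V) :
    (sumSqForm b).baseChange ℂ x y =
      ∑ i, (Algebra.TensorProduct.basis ℂ b).repr x i *
        (Algebra.TensorProduct.basis ℂ b).repr y i := by
  induction x using TensorProduct.induction_on with
  | zero => simp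
  | tmul a v =>
    induction y using TensorProduct.induction_on with
    | zero => simp
    | tmul c w =>
      simp only [LinearMap.BilinForm.baseChange_tmul, sumSqForm_apply,
        Algebra.TensorProduct.basis_repr_tmul, Finsupp.smul_apply, Finsupp.mapRange_apply,
        smul_eq_mul, eq_ratCast]
      rw [Algebra.smul_def, eq_ratCast]
      push_cast
      rw [Finset.sum_mul]
      exact Finset.sum_congr rfl fun i _ ↦ by ring
    | add y₁ y₂ h₁ h₂ =>
      simp only [map_add, h₁, h₂, Finsupp.add_apply, mul_add, Finset.sum_add_distrib]
  | add x₁ x₂ h₁ h₂ =>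
    simp only [map_add, LinearMap.add_apply, h₁, h₂, Finsupp.add_apply, add_mul,
      Finset.sum_add_distrib]

/-- `Q_{b,ℂ}(x, x̄) = Σᵢ |xᵢ|²` (a non-negative real number). [folklore] -/
theorem sumSqForm_baseChange_conj (b : Module.Basis ι ℚ V) (x : ℂ ⊗[ℚ] V) :
    (sumSqForm b).baseChange ℂ x (conj x) =
      ((∑ i, Complex.normSq ((Algebra.TensorProduct.basis ℂ b).repr x i) : ℝ) : ℂ) := by
  rw [sumSqForm_baseChange_apply]
  push_cast
  exact Finset.sum_congr rfl fun i _ ↦ by rw [basis_repr_conj, Complex.mul_conj]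

/-- Positivity: `Q_{b,ℂ}(x, x̄) = Σᵢ |xᵢ|² > 0` for `x ≠ 0`. [folklore] -/
theorem sumSqForm_baseChange_conj_pos (b : Module.Basis ι ℚ V) {x : ℂ ⊗[ℚ] V} (hx : x ≠ 0) :
    ∃ r : ℝ, 0 < r ∧ (sumSqForm b).baseChange ℂ x (conj x) = r := by
  refine ⟨∑ i, Complex.normSq ((Algebra.TensorProduct.basis ℂ b).repr x i), ?_,
    sumSqForm_baseChange_conj b x⟩
  have hne : (Algebra.TensorProduct.basis ℂ b).repr x ≠ 0 := fun h ↦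
    hx ((Algebra.TensorProduct.basis ℂ b).repr.map_eq_zero_iff.1 h)
  obtain ⟨i, hi⟩ := DFunLike.ne_iff.1 hne
  have hi' : (Algebra.TensorProduct.basis ℂ b).repr x i ≠ 0 := by simpa using hi
  exact Finset.sum_pos' (fun j _ ↦ Complex.normSq_nonneg _)
    ⟨i, Finset.mem_univ _, Complex.normSq_pos.2 hi'⟩

end SumOfSquares

/-! ### Structures purely of type `(k,k)` are polarizable -/

section Pure

variable {n : ℤ}

/-- **The sum-of-squares form polarizes a Hodge structure purely of type `(k,k)`** on a
finite-dimensional `V` (weight `m = 2k`): it is symmetric (`(-1)^{2k} = 1`), the first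
Hodge–Riemann relation is empty (one of `F^p`, `F^{m+1-p}` is `0`), and on the only piece
`V^{k,k} = V_ℂ` the untwisted positivity `i^{k-k} Q_ℂ(x, x̄) = Σᵢ |xᵢ|² > 0` holds
(Voisin I, §7.1.2; Deligne, Hodge II, 2.1.15 for `ℚ(0)`-type structures). The basis is
`Module.finBasis ℚ V`. [cite: VoisinHodgeI2002, §7.1.2] -/
def Polarization.pure [Module.Finite ℚ V] (k m : ℤ) (hm : m = 2 * k) :
    Polarization (pure V k m hm) where
  form := sumSqForm (Module.finBasis ℚ V)
  flip_form := by
    subst hm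
    rw [Int.negOnePow_two_mul, Units.val_one, one_smul]
    refine LinearMap.ext fun v ↦ LinearMap.ext fun w ↦ ?_
    exact sumSqForm_comm _ w v
  form_apply_eq_zero p x hx y hy := by
    by_cases hp : p ≤ k
    · have hq : k < m + 1 - p := by omega
      rw [pure_F, pureFiltration_of_lt hq, Submodule.mem_bot] at hy
      rw [hy, map_zero]
    · rw [pure_F, pureFiltration_of_lt (not_le.1 hp), Submodule.mem_bot] at hx
      rw [hx, map_zero, LinearMap.zero_apply]
  pos p q hpq x hx hx0 := by
    obtain ⟨rfl, rfl⟩ : p = k ∧ q = k := by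
      by_contra h
      rw [piece_pure_eq_bot hm h, Submodule.mem_bot] at hx
      exact hx0 hx
    rw [mul_inv_cancel₀ (zpow_ne_zero _ Complex.I_ne_zero), one_mul]
    exact sumSqForm_baseChange_conj_pos _ hx0

/-- A Hodge structure purely of type `(k,k)` on a finite-dimensional `ℚ`-vector space is
polarizable (by the sum-of-squares form of a basis). [cite: VoisinHodgeI2002, §7.1.2] -/
theorem isPolarizable_pure [Module.Finite ℚ V] (k m : ℤ) (hm : m = 2 * k) :
    (pure V k m hm).IsPolarizable :=
  ⟨Polarization.pure k m hm⟩

/-- The trivial weight-`0` Hodge structure on a finite-dimensional space is polarizable.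
[cite: DeligneHodgeII1971, 2.1.13 and 2.1.15] -/
theorem isPolarizable_ofWeightZero [Module.Finite ℚ V] : (ofWeightZero V).IsPolarizable :=
  isPolarizable_pure 0 0 (by ring)

/-! ### `Hdgᵖ = V` forces purity of type `(p,p)` -/

/-- If every rational vector of a Hodge structure is of filtration level `p`
(`hodgeClasses p = ⊤`), then `F^p = V_ℂ`: the complexification is spanned by the real
vectors `1 ⊗ v`. [cite: VoisinHodgeI2002, §7.1.1] -/
theorem F_eq_top_of_hodgeClasses_eq_top (H : HodgeStructure V n) {p : ℤ}
    (h : H.hodgeClasses p = ⊤) : H.F p = ⊤ := by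
  refine eq_top_iff.2 fun x _ ↦ ?_
  induction x using TensorProduct.induction_on with
  | zero => exact Submodule.zero_mem _
  | tmul a v =>
    have hv : ofRat v ∈ H.F p := (H.mem_hodgeClasses_iff p v).1 (h ▸ Submodule.mem_top)
    have : a ⊗ₜ[ℚ] v = a • ofRat v := by
      rw [ofRat_apply, TensorProduct.smul_tmul', smul_eq_mul, mul_one]
    rw [this]
    exact Submodule.smul_mem _ a hv
  | add x y hx hy => exact Submodule.add_mem _ (hx Submodule.mem_top) (hy Submodule.mem_top)

/-- In weight `n = 2p`, if every rational vector is a Hodge class then `F^{p'} = 0` for every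
`p' > p` (opposedness of `F^{p'}` and `conj F^{n+1-p'} ⊇ conj F^p = V_ℂ`).
[cite: DeligneHodgeII1971, 1.2.5] -/
theorem F_eq_bot_of_hodgeClasses_eq_top (H : HodgeStructure V n) {p : ℤ} (hp : p + p = n)
    (h : H.hodgeClasses p = ⊤) {p' : ℤ} (hlt : p < p') : H.F p' = ⊥ := by
  have htop : H.F (n + 1 - p') = ⊤ :=
    eq_top_iff.2 ((H.F_eq_top_of_hodgeClasses_eq_top h).symm ▸ H.antitone_F (by omega))
  have hc := (H.isCompl_F_complexConj p' (n + 1 - p') (by omega)).disjoint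
  rw [htop, complexConj_top, disjoint_top] at hc
  exact hc

/-- In weight `n = 2p`, if every rational vector is a Hodge class then all Hodge pieces
`V^{p',q'}` with `p' ≠ p` vanish: the structure is purely of type `(p,p)`.
[cite: DeligneHodgeII1971, 1.2.5] -/
theorem piece_eq_bot_of_hodgeClasses_eq_top (H : HodgeStructure V n) {p : ℤ} (hp : p + p = n)
    (h : H.hodgeClasses p = ⊤) {p' q' : ℤ} (hne : p' ≠ p) : H.piece p' q' = ⊥ := by
  by_cases hpq : p' + q' = n
  · rcases lt_or_gt_of_ne hne with hlt | hlt
    · have hq : p < q' := by omega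
      refine eq_bot_iff.2 ((H.piece_le_complexConj_F p' q').trans ?_)
      rw [H.F_eq_bot_of_hodgeClasses_eq_top hp h hq, complexConj_bot]
    · refine eq_bot_iff.2 ((H.piece_le_F p' q').trans ?_)
      rw [H.F_eq_bot_of_hodgeClasses_eq_top hp h hlt]
  · exact H.piece_eq_bot_of_add_ne hpq

/-- In weight `n = 2p`, if every rational vector is a Hodge class then `h^{p',q'} = 0` for all
`p' ≠ p`. Contrapositively: one non-zero off-diagonal Hodge number exhibits a rational vector
which is not a Hodge class. [cite: VoisinHodgeI2002, §7.1.1] -/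
theorem hodgeNumber_eq_zero_of_hodgeClasses_eq_top (H : HodgeStructure V n) {p : ℤ}
    (hp : p + p = n) (h : H.hodgeClasses p = ⊤) {p' q' : ℤ} (hne : p' ≠ p) :
    H.hodgeNumber p' q' = 0 := by
  rw [hodgeNumber, H.piece_eq_bot_of_hodgeClasses_eq_top hp h hne, finrank_bot]

/-! ### Re-decorating even weights purely of type `(n/2, n/2)` -/

/-- The **pure re-decoration** of a Hodge structure `H` of weight `n`: the structure purely of
type `(n/2, n/2)` on the same space if `n` is even (`HodgeStructure.pure`; Deligne, Hodge II,
2.1.13), and `H` itself if `n` is odd. [cite: DeligneHodgeII1971, 2.1.13] -/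
def pureOfEven (H : HodgeStructure V n) : HodgeStructure V n :=
  if h : Even n then pure V (n / 2) n (by obtain ⟨r, hr⟩ := h; omega) else H

/-- In even weight the pure re-decoration is `pure V (n/2) n`. [folklore] -/
theorem pureOfEven_of_even (H : HodgeStructure V n) (h : Even n) :
    H.pureOfEven = pure V (n / 2) n (by obtain ⟨r, hr⟩ := h; omega) :=
  dif_pos h

/-- In odd weight the pure re-decoration changes nothing. [folklore] -/
theorem pureOfEven_of_not_even (H : HodgeStructure V n) (h : ¬Even n) : H.pureOfEven = H :=
  dif_neg h

/-- The Hodge filtration of the pure re-decoration in even weight is the one-step filtration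
at `n/2`. [folklore] -/
theorem pureOfEven_F_of_even (H : HodgeStructure V n) (h : Even n) (p : ℤ) :
    H.pureOfEven.F p = pureFiltration V (n / 2) p := by
  rw [pureOfEven_of_even H h, pure_F]

/-- In even weight `n = 2p`, EVERY rational vector is a Hodge class of the pure re-decoration:
`Hdgᵖ = V`. [cite: DeligneHodgeII1971, 2.1.13] -/
theorem hodgeClasses_pureOfEven_of_even (H : HodgeStructure V n) (h : Even n) {p : ℤ}
    (hp : 2 * p = n) : H.pureOfEven.hodgeClasses p = ⊤ := by
  refine eq_top_iff.2 fun v _ ↦ ?_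
  rw [mem_hodgeClasses_iff, pureOfEven_F_of_even H h, pureFiltration_of_le (by omega)]
  exact Submodule.mem_top

/-- A morphism of Hodge structures stays a morphism after pure re-decoration of source and
target: in even weight any linear map respects the one-step filtrations, in odd weight nothing
changed. [cite: DeligneHodgeII1971, 2.1.13] -/
def Hom.pureOfEven {H₁ : HodgeStructure V n} {H₂ : HodgeStructure W n} (φ : Hom H₁ H₂) :
    Hom H₁.pureOfEven H₂.pureOfEven where
  toLinearMap := φ.toLinearMap
  map_F_le p := by
    by_cases h : Even n
    · rw [pureOfEven_F_of_even H₁ h, pureOfEven_F_of_even H₂ h]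
      by_cases hp : p ≤ n / 2
      · rw [pureFiltration_of_le (V := W) hp]
        exact le_top
      · rw [pureFiltration_of_lt (V := V) (not_le.1 hp), Submodule.map_bot]
        exact bot_le
    · rw [pureOfEven_of_not_even H₁ h, pureOfEven_of_not_even H₂ h]
      exact φ.map_F_le p

/-- The pure re-decoration keeps the underlying linear map of a morphism. [folklore] -/
@[simp]
theorem Hom.pureOfEven_toLinearMap {H₁ : HodgeStructure V n} {H₂ : HodgeStructure W n}
    (φ : Hom H₁ H₂) : φ.pureOfEven.toLinearMap = φ.toLinearMap := rfl

/-- The pure re-decoration of a polarizable Hodge structure on a finite-dimensional space is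
polarizable (even weight: `isPolarizable_pure`; odd weight: unchanged).
[cite: VoisinHodgeI2002, §7.1.2] -/
theorem IsPolarizable.pureOfEven [Module.Finite ℚ V] {H : HodgeStructure V n}
    (hH : H.IsPolarizable) : H.pureOfEven.IsPolarizable := by
  by_cases h : Even n
  · rw [pureOfEven_of_even H h]
    exact isPolarizable_pure _ _ _
  · rw [pureOfEven_of_not_even H h]
    exact hH

end Pure

end HodgeStructure

/-! ### The pure-even re-decoration of a Betti–Hodge datum -/

namespace BettiHodgeData

variable {k : Type} [Field k] [Algebra k ℂ]

/-- **The pure-even re-decoration of a Betti–Hodge realization datum**: same Weil cohomology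
`W`, same comparison `iso` with Betti cohomology, but the Hodge structure on each `H²ᵖ(X)`
replaced by the structure purely of type `(p,p)` (`HodgeStructure.pureOfEven`; Deligne, Hodge II,
2.1.13), odd degrees unchanged. The axioms of `BettiHodgeData` survive: pull-backs remain
morphisms (`HodgeStructure.Hom.pureOfEven`), polarizability is preserved
(`HodgeStructure.IsPolarizable.pureOfEven`, `Hⁱ(X)` being finite-dimensional by the Weil axiom
(A), Kleiman 1968, §1.2), and every class of `H²ᵖ(X)` — in particular every cycle class — is now
a Hodge class. [cite: DeligneHodgeII1971, 2.1.13] -/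
def pureEven (B : BettiHodgeData k) : BettiHodgeData k where
  W := B.W
  iso := B.iso
  iso_cup := B.iso_cup
  iso_one := B.iso_one
  hodge _ _ hX i := (B.hodge hX i).pureOfEven
  pullback_hom _ _ hX _ _ hY f i := by
    obtain ⟨φ, hφ⟩ := B.pullback_hom hX hY f i
    exact ⟨φ.pureOfEven, hφ⟩
  polarizable _ _ hX i := by
    haveI : Module.Finite ℚ (B.W.obj _ i) := B.W.finite_obj hX i
    exact (B.polarizable hX i).pureOfEven
  cycleClass_mem_hodgeClasses _ _ hX p z _ := by
    rw [HodgeStructure.hodgeClasses_pureOfEven_of_even _ ⟨p, by push_cast; ring⟩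
      (by push_cast; ring)]
    exact Submodule.mem_top

/-- The pure-even re-decoration keeps the Weil cohomology (and the comparison). [folklore] -/
@[simp]
theorem pureEven_W (B : BettiHodgeData k) : B.pureEven.W = B.W := rfl

/-- The Hodge structures of the pure-even re-decoration are the pure re-decorations of the
original ones. [folklore] -/
theorem pureEven_hodge (B : BettiHodgeData k) {n : ℕ} {X : SchemeOver k}
    (hX : IsSmoothProjective n X) (i : ℕ) : B.pureEven.hodge hX i = (B.hodge hX i).pureOfEven :=
  rfl

/-- In odd degree the pure-even re-decoration changes nothing. [folklore] -/
theorem pureEven_hodge_of_odd (B : BettiHodgeData k) {n : ℕ} {X : SchemeOver k}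
    (hX : IsSmoothProjective n X) {i : ℕ} (hi : Odd i) : B.pureEven.hodge hX i = B.hodge hX i :=
  HodgeStructure.pureOfEven_of_not_even _ (Int.not_even_iff_odd.2 (by exact_mod_cast hi))

/-- **Every class of `H²ᵖ(X)` is a Hodge class of the pure-even re-decoration**:
`Hdgᵖ(B.pureEven, X) = H²ᵖ(X)`. [cite: DeligneHodgeII1971, 2.1.13] -/
theorem hodgeClasses_pureEven_two_mul (B : BettiHodgeData k) {n : ℕ} {X : SchemeOver k}
    (hX : IsSmoothProjective n X) (p : ℕ) :
    (B.pureEven.hodge hX (2 * p)).hodgeClasses p = ⊤ :=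
  HodgeStructure.hodgeClasses_pureOfEven_of_even _ ⟨p, by push_cast; ring⟩ (by push_cast; ring)

/-- **The `B`-relative Hodge conjecture for the pure-even re-decoration says that the cycle
classes SPAN `H²ᵖ(X)`:** `B.pureEven.HodgeConjectureFor hX p ↔ ℚ · Aᵖ(X) = H²ᵖ(X)`.
[cite: DeligneHodgeII1971, 2.1.13] -/
theorem pureEven_hodgeConjectureFor_iff (B : BettiHodgeData k) {n : ℕ} {X : SchemeOver k}
    (hX : IsSmoothProjective n X) (p : ℕ) :
    B.pureEven.HodgeConjectureFor hX p ↔ B.W.algebraicClasses X p = ⊤ := by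
  rw [HodgeConjectureFor, hodgeClasses_pureEven_two_mul]
  rfl

/-- If the cycle classes do not span `H²ᵖ(X)`, the `B`-relative Hodge conjecture fails for the
pure-even re-decoration at `(X, p)`. [folklore] -/
theorem not_pureEven_hodgeConjectureFor (B : BettiHodgeData k) {n : ℕ} {X : SchemeOver k}
    (hX : IsSmoothProjective n X) {p : ℕ} (h : B.W.algebraicClasses X p ≠ ⊤) :
    ¬B.pureEven.HodgeConjectureFor hX p :=
  fun h' ↦ h ((B.pureEven_hodgeConjectureFor_iff hX p).1 h')

/-- **One non-zero off-diagonal Hodge number bounds the algebraic classes away from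
everything:** if `h^{p',q'}(B, X) ≠ 0` for some `p' ≠ p` in degree `2p`, then the classes of
codimension-`p` cycles do not span `H²ᵖ(X)` (they are Hodge classes,
`algebraicClasses_le_hodgeClasses`, and `Hdgᵖ = H²ᵖ` would force purity of type `(p,p)`,
`HodgeStructure.hodgeNumber_eq_zero_of_hodgeClasses_eq_top`). [cite: VoisinHodgeI2002, §7.1.1 and Prop. 11.20] -/
theorem algebraicClasses_ne_top_of_hodgeNumber_ne_zero (B : BettiHodgeData k) {n : ℕ}
    {X : SchemeOver k} (hX : IsSmoothProjective n X) {p : ℕ} {p' q' : ℤ} (hne : p' ≠ p)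
    (h : (B.hodge hX (2 * p)).hodgeNumber p' q' ≠ 0) : B.W.algebraicClasses X p ≠ ⊤ := by
  intro htop
  refine h ((B.hodge hX (2 * p)).hodgeNumber_eq_zero_of_hodgeClasses_eq_top
    (p := p) (by push_cast; ring) ?_ hne)
  exact eq_top_iff.2 (htop ▸ B.algebraicClasses_le_hodgeClasses hX p)

/-- **The pure-even re-decoration violates the `B`-relative Hodge conjecture at `(X, p)` as soon
as `B` sees a non-zero off-diagonal Hodge number in degree `2p`** (e.g. `h^{2,0}(X) ≠ 0` for
`p = 1`, `h^{3,1}(X) ≠ 0` for `p = 2`). [cite: VoisinHodgeI2002, §7.1.1 and Prop. 11.20] -/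
theorem not_pureEven_hodgeConjectureFor_of_hodgeNumber_ne_zero (B : BettiHodgeData k) {n : ℕ}
    {X : SchemeOver k} (hX : IsSmoothProjective n X) {p : ℕ} {p' q' : ℤ} (hne : p' ≠ p)
    (h : (B.hodge hX (2 * p)).hodgeNumber p' q' ≠ 0) : ¬B.pureEven.HodgeConjectureFor hX p :=
  B.not_pureEven_hodgeConjectureFor hX (B.algebraicClasses_ne_top_of_hodgeNumber_ne_zero hX hne h)

/-- **No Hodge-conjecture-type statement against an abstract datum holds for ALL data** at an
`(X, p)` where some datum sees a non-zero off-diagonal Hodge number in degree `2p`: the fields of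
`BettiHodgeData` do not pin the even-degree Hodge structures down (witness `B.pureEven`). This is
why the tree's statements against an abstract `B` are predicates of `B` and not theorems
(module docstrings of `Motives/Sweep1`, `Motives/BettiCycleClass`).
[cite: VoisinHodgeI2002, §7.1.1 and Prop. 11.20] -/
theorem not_forall_hodgeConjectureFor_of_hodgeNumber_ne_zero (B : BettiHodgeData k) {n : ℕ}
    {X : SchemeOver k} (hX : IsSmoothProjective n X) {p : ℕ} {p' q' : ℤ} (hne : p' ≠ p)
    (h : (B.hodge hX (2 * p)).hodgeNumber p' q' ≠ 0) :
    ¬∀ B' : BettiHodgeData k, B'.HodgeConjectureFor hX p :=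
  fun hall ↦ B.not_pureEven_hodgeConjectureFor_of_hodgeNumber_ne_zero hX hne h (hall B.pureEven)

end BettiHodgeData

end Literature.AlgebraicGeometry.Motives

end
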